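import Summits.Parity.GeneralizedHardyLittlewood.Theses.HomothetyPencil

/-!
# Route `HomothetyPencil` — the `[assembly]` item (stmt-Parity-32288)

decomp-parity node «HomothetyPencil» (lens-4 g7; critic CLEARED HOME/STATUS.md l.436, CRITIC-LEDGER row 81 as
the T11 notch G1.2.P beneath FU ∧ FL; route born rev 0 by lens-4 g7, commit 0e977355f992, STATUS l.451): the
assembly `BoundedSiegelZeroQuality → UniformUpperGivenFixed → UniformLowerGivenFixed → PencilHL → PencilRigidity →
GeneralizedHardyLittlewood` is literally the route's gate-written deciding theorem `closes` (D-0027 §2.1),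
curried.  Hand by the cell's prover-class seat (census-1 g10); no mathematics beyond the route file.
-/

namespace Summit.Parity.GeneralizedHardyLittlewood.Theses.HomothetyPencil

/-- **The `[assembly]` item holds** (stmt-Parity-32288): the five route items imply
`GeneralizedHardyLittlewood`, by the route's deciding theorem `closes`. -/
theorem assembly_proof : Assembly :=
  fun hQ hUU hUL hP hR => closes hQ hUU hUL hP hR

end Summit.Parity.GeneralizedHardyLittlewood.Theses.HomothetyPencil
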